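/-
Copyright (c) 2026. All rights reserved.
Released under Apache 2.0 license as described in the file LICENSE.
-/
import Literature.AlgebraicGeometry.Pohlmann1968.CMTypeRankTwo
import Literature.AlgebraicGeometry.Pohlmann1968.DegenerateCMTypesMultiquadraticCMFieldWeilCount
import Literature.AlgebraicGeometry.Pohlmann1968.NondegenerateCMTypeHodgeConjecture
import HarnessLib

/-!
# Multiquadratic CM fields of degree `16` (`K = ℚ(√−d, √a, √b, √c)`, `Gal ≅ (ℤ/2)⁴`): the Hodge conjecture for every
# power of every abelian variety of CM type `(K; Φ)` UNLESS `Φ` is of Weil type over exactly FOUR of the eight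
# imaginary quadratic subfields (rank `5`); and the two extreme ranks over any CM field

The tree computes, for a multiquadratic CM field `K` of degree `16` and any CM type `Φ`: `Rank(Φ) ∈ {9, 5, 2}`
(`DegenerateCMTypesMultiquadraticCMFieldParity`, seat p10 g37-#4; T. Kubota [Kubota1965] §4 Lemma 2 and Parseval),
`Rank(Φ) + #W(Φ) = 9` with `W(Φ)` the imaginary quadratic subfields over which `Φ` is of Weil type (g37-#2; B. Dodson
[Dodson1984] §3.1.1), so `#W(Φ) ∈ {0, 4, 7}` (g37-#7).  The two EXTREME ranks carry the Hodge conjecture for all powers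
over any CM field: the maximal rank is nondegeneracy (Hazama–Murty, tree `IsNondegenerate.hodgeConjectureFor_pow`;
B. B. Gordon [Gordon1999HodgeAVSurvey] Thm. 6.4), the minimal rank `2` is `A ∼ E^h` (tree `CMTypeRankTwo`, g37-#9).

* §1 (any CM field) **`hodgeConjectureFor_pow_of_cmTypeRank_extreme`** — `Rank(Φ) = 2 ∨ Rank(Φ) = [K:ℚ]/2 + 1` ⟹
  the Hodge conjecture for every power of every realisation; `hodgeClassSpan_pow_eq_divisorClassesSpan_of_cmTypeRank_extreme`.
* §2 (multiquadratic, `[K:ℚ] = 16`) **`hodgeConjectureFor_pow_of_cmTypeRank_ne_five_of_finrank_eq_sixteen`** —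
  `Rank(Φ) ≠ 5` ⟹ the Hodge conjecture for `Aⁿ`, every `n`, every realisation;
  `cmTypeRank_eq_five_iff_ncard_weilQuadratic_eq_four_of_finrank_eq_sixteen` (the excluded case: `Φ` of Weil type over
  exactly `4` of the `8` imaginary quadratic subfields); **`hodgeConjectureFor_pow_of_ncard_weilQuadratic_ne_four`** —
  THE HODGE CONJECTURE FOR EVERY POWER OF EVERY ABELIAN `8`-FOLD WITH CM BY A MULTIQUADRATIC FIELD OF DEGREE `16` WHOSE
  TYPE IS NOT OF WEIL TYPE OVER EXACTLY FOUR IMAGINARY QUADRATIC SUBFIELDS;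
  `hodgeClassSpan_pow_eq_divisorClassesSpan_of_ncard_weilQuadratic_ne_four` (`Bᵐ(Aⁿ) ⊗ ℂ = Dᵐ(Aⁿ) ⊗ ℂ`),
  `isSimple_of_ncard_weilQuadratic_eq_zero` / `not_isSimple_of_ncard_weilQuadratic_eq_seven`.

HONEST SCOPE.  The rank-`5` types of a degree-`16` multiquadratic CM field (Weil type over exactly four imaginary
quadratic subfields — e.g. types induced from a primitive type of an octic subfield, or primitive degenerate types if
any) are NOT treated: there the Hodge ring of some power is not generated by divisors.  THEOREMS ONLY: no definition,
no named fact, no instance, no `sorry`.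

## References

* [Kubota1965] T. Kubota, Trans. AMS 118 (1965), §4 Lemma 2.
* [Dodson1984] B. Dodson, Trans. AMS 283 (1984), §3.1.1 Theorem.
* [Gordon1999HodgeAVSurvey] B. B. Gordon, Thm. 6.4, §9.3.
* [Ribet1980] K. A. Ribet, §3 (3.5), Examples (3.7).

## Provenance

Lane `lit-hodgefound` (Track 2, Layer A5), seat `lit-hodgefound-p10` generation 37, row g37-#10; neighbours cited by
name, nothing restated: `CMTypeRankTwo` (`hodgeConjectureFor_pow_of_cmTypeRank_eq_two`,
`hodgeClassSpan_pow_eq_divisorClassesSpan_of_cmTypeRank_eq_two`, `not_isSimple_of_cmTypeRank_eq_two`),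
`NondegenerateCMTypeHodgeConjecture` / `NondegenerateCMTypeDivisorClasses` (`IsNondegenerate.hodgeConjectureFor_pow`,
`IsNondegenerate.hodgeClassSpan_pow_eq_divisorClassesSpan`, `IsNondegenerate.isPrimitive`),
`DegenerateCMTypesMultiquadraticCMFieldParity` (`cmTypeRank_mem_of_finrank_eq_sixteen`),
`DegenerateCMTypesMultiquadraticCMField` (`cmTypeRank_add_ncard_weilQuadratic_eq`), `SimpleIffPrimitiveCMType`.
-/

open scoped Classical NumberField
open NumberField Module CategoryTheory CategoryTheory.Limits

namespace Literature.AlgebraicGeometry.Pohlmann1968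

open scoped Literature.NumberTheory.ComplexMultiplication
open Literature.NumberTheory.ComplexMultiplication (IsPrimitive)
open Literature.AlgebraicGeometry.Motives (CMType AbelianVariety)
open Literature.AlgebraicGeometry.HodgeTheory
open Literature.AlgebraicGeometry.VanGeemen1994 (hodgeClassSpan)
open Literature.Barriers.HodgeConjecture (divisorClassesSpan)
open Literature.AlgebraicGeometry.ComplexMultiplication (IsCMTypeRealisation isSimple_iff_isPrimitive)

variable {K : Type} [Field K] [NumberField K] [IsCMField K]
  {A : AbelianVariety ℂ} {ι : 𝓞 K →+* End A} {θ : K →+* Module.End ℂ (complexBetti A.X 1)}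

/-! ## §1 The two extreme ranks, over any CM field -/

/-- **`Bᵐ(Aⁿ) ⊗ ℂ = Dᵐ(Aⁿ) ⊗ ℂ` at the two EXTREME ranks**: if `Rank(Φ) = 2` (minimal: `A ∼ E^h`) or
`Rank(Φ) = [K:ℚ]/2 + 1` (maximal: `Φ` nondegenerate), then the Hodge classes of every power of every realisation are
spanned by products of divisor classes. [cite: Gordon1999HodgeAVSurvey, Thm. 6.4 and §9.3] [cite: Ribet1980, §3 Examples (3.7) (p. 87)] -/
theorem hodgeClassSpan_pow_eq_divisorClassesSpan_of_cmTypeRank_extreme (Φ : CMType K)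
    (hr : cmTypeRank Φ = 2 ∨ cmTypeRank Φ = finrank ℚ K / 2 + 1) (hA : IsCMTypeRealisation Φ A ι θ) (n m : ℕ) :
    hodgeClassSpan (⨁ fun _ : Fin n => A).dim (⨁ fun _ : Fin n => A).X m =
      divisorClassesSpan (⨁ fun _ : Fin n => A).X (⨁ fun _ : Fin n => A).dim m := by
  rcases hr with h2 | hmax
  · exact hodgeClassSpan_pow_eq_divisorClassesSpan_of_cmTypeRank_eq_two Φ h2 hA n m
  · exact ((isNondegenerate_iff Φ).2 hmax).hodgeClassSpan_pow_eq_divisorClassesSpan hA n m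

/-- **THE HODGE CONJECTURE FOR EVERY POWER AT THE TWO EXTREME RANKS** (`Rank(Φ) = 2` or `Rank(Φ) = [K:ℚ]/2 + 1`), any
CM field, any realisation. [cite: Gordon1999HodgeAVSurvey, Thm. 6.4 and §9.3] [cite: Ribet1980, §3 Examples (3.7) (p. 87)] -/
theorem hodgeConjectureFor_pow_of_cmTypeRank_extreme (Φ : CMType K)
    (hr : cmTypeRank Φ = 2 ∨ cmTypeRank Φ = finrank ℚ K / 2 + 1) (hA : IsCMTypeRealisation Φ A ι θ) (n : ℕ) :
    HodgeConjectureFor (⨁ fun _ : Fin n => A).dim (⨁ fun _ : Fin n => A).X := by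
  rcases hr with h2 | hmax
  · exact hodgeConjectureFor_pow_of_cmTypeRank_eq_two Φ h2 hA n
  · exact ((isNondegenerate_iff Φ).2 hmax).hodgeConjectureFor_pow hA n

/-! ## §2 Multiquadratic CM fields of degree `16` -/

section DegreeSixteen

variable [IsGalois ℚ K]

/-- **Degree `16`, `Rank(Φ) ≠ 5` ⟹ `Bᵐ(Aⁿ) ⊗ ℂ = Dᵐ(Aⁿ) ⊗ ℂ` for all `n, m`** (`Rank ∈ {9, 5, 2}`; `9` is nondegenerate,
`2` is `A ∼ E⁸`). [cite: Kubota1965, §4 Lemma 2] [cite: Gordon1999HodgeAVSurvey, Thm. 6.4 and §9.3] -/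
theorem hodgeClassSpan_pow_eq_divisorClassesSpan_of_cmTypeRank_ne_five_of_finrank_eq_sixteen
    (hexp : ∀ g : K ≃ₐ[ℚ] K, g ^ 2 = 1) (h16 : finrank ℚ K = 16) (Φ : CMType K) (hr : cmTypeRank Φ ≠ 5)
    (hA : IsCMTypeRealisation Φ A ι θ) (n m : ℕ) :
    hodgeClassSpan (⨁ fun _ : Fin n => A).dim (⨁ fun _ : Fin n => A).X m =
      divisorClassesSpan (⨁ fun _ : Fin n => A).X (⨁ fun _ : Fin n => A).dim m := by
  refine hodgeClassSpan_pow_eq_divisorClassesSpan_of_cmTypeRank_extreme Φ ?_ hA n m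
  rcases Multiquadratic.cmTypeRank_mem_of_finrank_eq_sixteen hexp h16 Φ with h9 | h5 | h2
  · right; rw [h9, h16]
  · exact absurd h5 hr
  · left; exact h2

/-- **Degree `16`, `Rank(Φ) ≠ 5` ⟹ THE HODGE CONJECTURE FOR `Aⁿ`, EVERY `n`**, every realisation `(A, ι, θ)` of `Φ`
(`K` multiquadratic CM of degree `16`). [cite: Kubota1965, §4 Lemma 2] [cite: Gordon1999HodgeAVSurvey, Thm. 6.4 and §9.3] -/
theorem hodgeConjectureFor_pow_of_cmTypeRank_ne_five_of_finrank_eq_sixteen (hexp : ∀ g : K ≃ₐ[ℚ] K, g ^ 2 = 1)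
    (h16 : finrank ℚ K = 16) (Φ : CMType K) (hr : cmTypeRank Φ ≠ 5) (hA : IsCMTypeRealisation Φ A ι θ) (n : ℕ) :
    HodgeConjectureFor (⨁ fun _ : Fin n => A).dim (⨁ fun _ : Fin n => A).X := by
  refine hodgeConjectureFor_pow_of_cmTypeRank_extreme Φ ?_ hA n
  rcases Multiquadratic.cmTypeRank_mem_of_finrank_eq_sixteen hexp h16 Φ with h9 | h5 | h2
  · right; rw [h9, h16]
  · exact absurd h5 hr
  · left; exact h2

/-- **Degree `16`: `Rank(Φ) = 5` ⟺ `Φ` is of Weil type over EXACTLY FOUR imaginary quadratic subfields** (`Rank + #W =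
9`). [cite: Kubota1965, §4 Lemma 2] [cite: Dodson1984, §3.1.1 Theorem] -/
theorem cmTypeRank_eq_five_iff_ncard_weilQuadratic_eq_four_of_finrank_eq_sixteen
    (hexp : ∀ g : K ≃ₐ[ℚ] K, g ^ 2 = 1) (h16 : finrank ℚ K = 16) (Φ : CMType K) :
    cmTypeRank Φ = 5 ↔ {F : IntermediateField ℚ K | finrank ℚ F = 2 ∧ ¬ IsTotallyReal F ∧
        ∀ τ : F →+* ℂ, {φ : K →+* ℂ | φ.comp (algebraMap F K) = τ ∧ φ ∈ Φ.1}.ncard =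
          {φ : K →+* ℂ | φ.comp (algebraMap F K) = τ ∧ φ ∉ Φ.1}.ncard}.ncard = 4 := by
  have key := Multiquadratic.cmTypeRank_add_ncard_weilQuadratic_eq hexp Φ
  rw [h16] at key
  omega

/-- **THE HODGE CONJECTURE FOR EVERY POWER OF EVERY ABELIAN `8`-FOLD WITH COMPLEX MULTIPLICATION BY A MULTIQUADRATIC CM
FIELD OF DEGREE `16` WHOSE CM TYPE IS NOT OF WEIL TYPE OVER EXACTLY FOUR IMAGINARY QUADRATIC SUBFIELDS** (`#W(Φ) ∈
{0, 4, 7}`; `#W = 0`: nondegenerate, simple; `#W = 7`: `A ∼ E⁸`). [cite: Kubota1965, §4 Lemma 2]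
[cite: Dodson1984, §3.1.1 Theorem] [cite: Gordon1999HodgeAVSurvey, Thm. 6.4 and §9.3] -/
theorem hodgeConjectureFor_pow_of_ncard_weilQuadratic_ne_four (hexp : ∀ g : K ≃ₐ[ℚ] K, g ^ 2 = 1)
    (h16 : finrank ℚ K = 16) (Φ : CMType K)
    (hW : {F : IntermediateField ℚ K | finrank ℚ F = 2 ∧ ¬ IsTotallyReal F ∧
        ∀ τ : F →+* ℂ, {φ : K →+* ℂ | φ.comp (algebraMap F K) = τ ∧ φ ∈ Φ.1}.ncard =
          {φ : K →+* ℂ | φ.comp (algebraMap F K) = τ ∧ φ ∉ Φ.1}.ncard}.ncard ≠ 4)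
    (hA : IsCMTypeRealisation Φ A ι θ) (n : ℕ) :
    HodgeConjectureFor (⨁ fun _ : Fin n => A).dim (⨁ fun _ : Fin n => A).X :=
  hodgeConjectureFor_pow_of_cmTypeRank_ne_five_of_finrank_eq_sixteen hexp h16 Φ
    (fun h5 => hW ((cmTypeRank_eq_five_iff_ncard_weilQuadratic_eq_four_of_finrank_eq_sixteen hexp h16 Φ).1 h5)) hA n

/-- **`Bᵐ(Aⁿ) ⊗ ℂ = Dᵐ(Aⁿ) ⊗ ℂ`** in the same situation (`#W(Φ) ≠ 4`). [cite: Kubota1965, §4 Lemma 2]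
[cite: Gordon1999HodgeAVSurvey, Thm. 6.4 and §9.3] -/
theorem hodgeClassSpan_pow_eq_divisorClassesSpan_of_ncard_weilQuadratic_ne_four (hexp : ∀ g : K ≃ₐ[ℚ] K, g ^ 2 = 1)
    (h16 : finrank ℚ K = 16) (Φ : CMType K)
    (hW : {F : IntermediateField ℚ K | finrank ℚ F = 2 ∧ ¬ IsTotallyReal F ∧
        ∀ τ : F →+* ℂ, {φ : K →+* ℂ | φ.comp (algebraMap F K) = τ ∧ φ ∈ Φ.1}.ncard =
          {φ : K →+* ℂ | φ.comp (algebraMap F K) = τ ∧ φ ∉ Φ.1}.ncard}.ncard ≠ 4)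
    (hA : IsCMTypeRealisation Φ A ι θ) (n m : ℕ) :
    hodgeClassSpan (⨁ fun _ : Fin n => A).dim (⨁ fun _ : Fin n => A).X m =
      divisorClassesSpan (⨁ fun _ : Fin n => A).X (⨁ fun _ : Fin n => A).dim m :=
  hodgeClassSpan_pow_eq_divisorClassesSpan_of_cmTypeRank_ne_five_of_finrank_eq_sixteen hexp h16 Φ
    (fun h5 => hW ((cmTypeRank_eq_five_iff_ncard_weilQuadratic_eq_four_of_finrank_eq_sixteen hexp h16 Φ).1 h5)) hA n m

/-- **Multiquadratic CM fields (any degree): `#W(Φ) = 0` ⟹ `A` is SIMPLE** (`Rank` maximal: nondegenerate ⟹ primitive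
⟹ simple). [cite: Kubota1965, §2 (p. 115) and §4 Lemma 2] [cite: Shimura1998, §8.2 Prop. 26] -/
theorem isSimple_of_ncard_weilQuadratic_eq_zero (hexp : ∀ g : K ≃ₐ[ℚ] K, g ^ 2 = 1) (Φ : CMType K)
    (hW : {F : IntermediateField ℚ K | finrank ℚ F = 2 ∧ ¬ IsTotallyReal F ∧
        ∀ τ : F →+* ℂ, {φ : K →+* ℂ | φ.comp (algebraMap F K) = τ ∧ φ ∈ Φ.1}.ncard =
          {φ : K →+* ℂ | φ.comp (algebraMap F K) = τ ∧ φ ∉ Φ.1}.ncard}.ncard = 0)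
    (hA : IsCMTypeRealisation Φ A ι θ) : A.IsSimple := by
  obtain ⟨φ₀⟩ : Nonempty (K →+* ℂ) := inferInstance
  have key := Multiquadratic.cmTypeRank_add_ncard_weilQuadratic_eq hexp Φ
  rw [hW, add_zero] at key
  exact (isSimple_iff_isPrimitive hA φ₀).2 (((isNondegenerate_iff Φ).2 key).isPrimitive φ₀)

/-- **Degree `16`, `#W(Φ) = 7` ⟹ `A` is NOT simple** (`Rank = 2`: `A ∼ E⁸`). [cite: Kubota1965, §4 Lemma 2]
[cite: Ribet1980, §3 Examples (3.7) (p. 87)] -/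
theorem not_isSimple_of_ncard_weilQuadratic_eq_seven (hexp : ∀ g : K ≃ₐ[ℚ] K, g ^ 2 = 1)
    (h16 : finrank ℚ K = 16) (Φ : CMType K)
    (hW : {F : IntermediateField ℚ K | finrank ℚ F = 2 ∧ ¬ IsTotallyReal F ∧
        ∀ τ : F →+* ℂ, {φ : K →+* ℂ | φ.comp (algebraMap F K) = τ ∧ φ ∈ Φ.1}.ncard =
          {φ : K →+* ℂ | φ.comp (algebraMap F K) = τ ∧ φ ∉ Φ.1}.ncard}.ncard = 7)
    (hA : IsCMTypeRealisation Φ A ι θ) : ¬ A.IsSimple := by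
  have key := Multiquadratic.cmTypeRank_add_ncard_weilQuadratic_eq hexp Φ
  rw [hW, h16] at key
  exact not_isSimple_of_cmTypeRank_eq_two (by omega) Φ hA (by omega)

end DegreeSixteen

end Literature.AlgebraicGeometry.Pohlmann1968
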